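import Summits.MatrixMultiplication.OmegaCensus.ThreeSetLineNormDivisibility
import Summits.MatrixMultiplication.OmegaCensus.ThreeSetLinePackedEnc
import HarnessLib

/-!
# Packed group-ring arithmetic for `ℤ_{≥0}[C_p]`, II: the semantics in `S = ℤ[X]/(Φ_p)` (toolkit for the norm filter)

ω-census `pub-omega`, family (b3), seat pub-omega-group gen 41.  Framing: lottery ticket; floor = certified bounds/negative
ranges.  VALUE: a kernel TOOL (the arithmetic layer of the certificate-free norm filter `ThreeSetLineNormDivisibility`); NOT
progress on ω.

A non-negative element of the group ring `ℤ[C_p]` is ONE numeral `a = Σ_{v<p} a_v X^v` (`ThreeSetLinePackedEnc`);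
`Phi a = Σ_{v<p} a_v ρ^v ∈ S = AdjoinRoot (cyclotomic p ℤ)` is its image and `mass a = Σ a_v`.  Here:
* `Phi_ofList` / `mass_ofList` / `ofList_lt` — a count vector `F` of length `p`: `Phi = lev ρ F`, `mass = Σ F`;
* `Phi_cmul` — the CYCLIC product `cmul`: `Phi`- and `mass`-multiplicative and `< X^p` when `mass a · mass b < X`;
* `Phi_nadd` — plain addition: additive when `mass a + mass b < X`;
* `Phi_perm` — the digit permutation `perm gi` realises `σ_g` (`g·gi ≡ 1`), keeps `mass` (re-indexing `sum_reindex_unit`);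
* `Phi_eq_readInt` — a numeral whose digits `1 … p−1` agree is the integer `a₀ − a₁` in `S` (`Σ_{v<p} ρ^v = 0`).
-/

namespace Summit.MatrixMultiplication.OmegaCensus

open Finset Polynomial LineInv

namespace LineNorm

/-! ## Semantics in `S` -/

section Sem

variable (p : ℕ) [hp : Fact p.Prime] (X : ℕ)

/-- The group-ring element of a numeral, read in `S`. [folklore] -/
noncomputable def Phi (a : ℕ) : S p := ∑ v ∈ range p, ((a / X ^ v % X : ℕ) : S p) * rho p ^ v

variable {p X}

omit hp in
/-- `Phi` as `encR` of the digit list. [folklore] -/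
theorem Phi_eq_encR (a : ℕ) : Phi p X a = encR (rho p) (dl p X a) := by
  rw [encR_eq_sum, length_dl]
  exact Finset.sum_congr rfl fun v hv => by rw [dl_getD (mem_range.1 hv)]

omit hp in
/-- `Phi` of a packed list with small entries and length `≤ p`. [folklore] -/
theorem Phi_enc (hX : 0 < X) (L : List ℕ) (hL : ∀ a ∈ L, a < X) (hlen : L.length ≤ p) :
    Phi p X (enc X L) = encR (rho p) L := by
  rw [Phi_eq_encR, dl_enc hX L hL, encR_eq_sum, encR_eq_sum, List.length_map, List.length_range,
    ← sum_getD_extend (rho p) L hlen]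
  exact Finset.sum_congr rfl fun v hv => by rw [getD_range_map _ (mem_range.1 hv)]

omit hp in
/-- `mass` of a packed list with small entries and length `≤ p`. [folklore] -/
theorem mass_enc (hX : 0 < X) (L : List ℕ) (hL : ∀ a ∈ L, a < X) (hlen : L.length ≤ p) :
    mass p X (enc X L) = L.sum := by
  unfold mass
  rw [dl_enc hX L hL, ← enc_one, ← enc_one L]
  have key : ∀ (n : ℕ) (M : List ℕ), M.length ≤ n → enc 1 ((List.range n).map fun v => M.getD v 0) = enc 1 M := by
    intro n
    induction n with
    | zero => intro M hM; rw [List.length_eq_zero_iff.1 (Nat.le_zero.1 hM)]; rfl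
    | succ n ih =>
      intro M hM
      rw [List.range_succ_eq_map, List.map_cons, List.map_map, enc]
      cases M with
      | nil =>
        simp only [List.getD_nil, one_mul]
        have := ih [] (by simp)
        simp only [List.getD_nil] at this
        rw [show (List.map ((fun v => (0 : ℕ)) ∘ Nat.succ) (List.range n)) = List.map (fun v => 0) (List.range n) from
          List.map_congr_left fun _ _ => rfl, this]; rfl
      | cons m M =>
        rw [List.length_cons] at hM
        rw [List.getD_cons_zero, enc, one_mul, one_mul]
        congr 1
        rw [← ih M (by omega)]
        exact congrArg _ (List.map_congr_left fun v _ => by simp)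
  exact key p L hlen

/-- **`ofList`**: a count vector `F` of length `p` with `Σ F < X`. [folklore] -/
theorem Phi_ofList (hX : 0 < X) {F : List ℕ} (hF : F.length = p) (hsum : F.sum < X) :
    Phi p X (ofList X F) = lev (rho p) (vecFn F : ZMod p → ℕ) := by
  have hlt : ∀ a ∈ F, a < X := fun _ ha => lt_of_le_of_lt (List.le_sum_of_mem ha) hsum
  rw [ofList, Phi_enc hX F hlt hF.le, encR_eq_sum, hF, lev]
  unfold vecFn zch
  exact (sum_val_eq_sum_range (fun i => (F.getD i 0 : S p) * rho p ^ i)).symm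

omit hp in
/-- [folklore] -/
theorem mass_ofList (hX : 0 < X) {F : List ℕ} (hF : F.length = p) (hsum : F.sum < X) :
    mass p X (ofList X F) = F.sum :=
  mass_enc hX F (fun _ ha => lt_of_le_of_lt (List.le_sum_of_mem ha) hsum) hF.le

omit hp in
/-- The primitives keep the invariant `a < X^p` (so that `enc (dl a) = a`); here for `ofList`. [folklore] -/
theorem ofList_lt {F : List ℕ} (hF : F.length = p) (hsum : F.sum < X) : ofList X F < X ^ p := by
  have := enc_lt (X := X) F fun _ ha => lt_of_le_of_lt (List.le_sum_of_mem ha) hsum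
  rwa [hF] at this

/-- **`cmul`**: the cyclic product (no carries when `mass a · mass b < X`). [folklore] -/
theorem Phi_cmul (hX : 0 < X) {a b : ℕ} (ha : a < X ^ p) (hb : b < X ^ p) (hm : mass p X a * mass p X b < X) :
    Phi p X (cmul p X a b) = Phi p X a * Phi p X b ∧ mass p X (cmul p X a b) = mass p X a * mass p X b ∧
      cmul p X a b < X ^ p := by
  have hp0 : 0 < p := hp.out.pos
  set A := dl p X a with hA
  set B := dl p X b with hB
  have ea : a = enc X A := (enc_dl ha).symm
  have eb : b = enc X B := (enc_dl hb).symm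
  set L := lconv A B with hL
  have hLsum : L.sum = mass p X a * mass p X b := by rw [hL, sum_lconv]; rfl
  have hLlt : ∀ x ∈ L, x < X := fun x hx => by
    obtain ⟨i, hi, rfl⟩ := List.getElem_of_mem hx
    rw [← List.getD_eq_getElem _ 0 hi]
    exact lt_of_le_of_lt (getD_le_sum L i) (hLsum ▸ hm)
  have hab : a * b = enc X L := by rw [ea, eb, ← enc_lconv]
  set T := L.take p
  set D := L.drop p
  have hTlt : ∀ x ∈ T, x < X := fun x hx => hLlt x (List.mem_of_mem_take hx)
  have hDlt : ∀ x ∈ D, x < X := fun x hx => hLlt x (List.mem_of_mem_drop hx)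
  have hcm : cmul p X a b = enc X (ladd T D) := by
    rw [cmul, hab, enc_mod_pow hX L hLlt, enc_div_pow hX L hLlt, enc_ladd]
  -- digits of `ladd T D` are `< X`
  have hladd : ∀ x ∈ ladd T D, x < X := fun x hx => by
    obtain ⟨i, hi, rfl⟩ := List.getElem_of_mem hx
    rw [← List.getD_eq_getElem _ 0 hi, ladd_getD, List.getD_eq_getElem?_getD, List.getElem?_take, List.getD_eq_getElem?_getD,
      List.getElem?_drop]
    split_ifs with h
    · rw [← List.getD_eq_getElem?_getD, ← List.getD_eq_getElem?_getD]
      exact lt_of_le_of_lt (getD_add_getD_le_sum L i (p + i) (by omega)) (hLsum ▸ hm)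
    · rw [Option.getD_none, zero_add, ← List.getD_eq_getElem?_getD]
      exact lt_of_le_of_lt (getD_le_sum L _) (hLsum ▸ hm)
  -- lengths
  have hlenA : A.length = p := length_dl p a
  have hlenB : B.length = p := length_dl p b
  have hlenT : T.length ≤ p := by rw [List.length_take]; exact min_le_left _ _
  have hlenL : L.length ≤ A.length + B.length := length_lconv_le A B
  have hlenD : D.length ≤ p := by rw [List.length_drop]; omega
  have hlenTD : (ladd T D).length ≤ p := by rw [length_ladd]; exact max_le hlenT hlenD
  refine ⟨?_, ?_, ?_⟩
  · -- Phi
    rw [hcm, Phi_enc hX _ hladd hlenTD, encR_ladd, ea, eb, Phi_enc hX A (dl_lt hX) hlenA.le,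
      Phi_enc hX B (dl_lt hX) hlenB.le, ← encR_lconv, ← hL]
    -- `encR L = encR T + encR D` using `ρ^p = 1`
    rw [show encR (rho p) L = encR (rho p) (T ++ D) by rw [List.take_append_drop], encR_append]
    by_cases hpl : p ≤ L.length
    · rw [List.length_take, min_eq_left hpl, root_pow_p, one_mul]
    · rw [not_le] at hpl
      have hD : D = [] := List.drop_eq_nil_of_le hpl.le
      rw [hD, encR, mul_zero, add_zero]
  · -- mass
    rw [hcm, mass_enc hX _ hladd hlenTD, sum_ladd, List.sum_take_add_sum_drop, hLsum]
  · -- bound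
    rw [hcm]
    exact lt_of_lt_of_le (enc_lt _ hladd) (Nat.pow_le_pow_right hX hlenTD)

omit hp in
/-- **`nadd`**: plain addition of numerals adds the group-ring elements (no carries when `mass a + mass b < X`). [folklore] -/
theorem Phi_nadd (hX : 0 < X) {a b : ℕ} (ha : a < X ^ p) (hb : b < X ^ p) (hm : mass p X a + mass p X b < X) :
    Phi p X (a + b) = Phi p X a + Phi p X b ∧ mass p X (a + b) = mass p X a + mass p X b ∧ a + b < X ^ p := by
  set A := dl p X a with hA
  set B := dl p X b with hB
  have ea : a = enc X A := (enc_dl ha).symm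
  have eb : b = enc X B := (enc_dl hb).symm
  have hlenA : A.length = p := length_dl p a
  have hlenB : B.length = p := length_dl p b
  have hab : a + b = enc X (ladd A B) := by rw [ea, eb, enc_ladd]
  have hlt : ∀ x ∈ ladd A B, x < X := fun x hx => by
    obtain ⟨i, hi, rfl⟩ := List.getElem_of_mem hx
    rw [← List.getD_eq_getElem _ 0 hi, ladd_getD]
    exact lt_of_le_of_lt (Nat.add_le_add (getD_le_sum A i) (getD_le_sum B i)) hm
  have hlen : (ladd A B).length ≤ p := by rw [length_ladd, hlenA, hlenB, max_self]
  refine ⟨?_, ?_, ?_⟩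
  · rw [hab, Phi_enc hX _ hlt hlen, encR_ladd, ea, eb, Phi_enc hX A (dl_lt hX) hlenA.le, Phi_enc hX B (dl_lt hX) hlenB.le]
  · rw [hab, mass_enc hX _ hlt hlen, sum_ladd]; rfl
  · rw [hab]; exact lt_of_lt_of_le (enc_lt _ hlt) (Nat.pow_le_pow_right hX hlen)

/-- `σ_j` on a character sum: `σ_j (Σ c_v ρ^v) = Σ c_v (ρ^j)^v`. [folklore] -/
theorem sig_sum_pow {j : ℕ} (hj : ¬ p ∣ j) (c : ℕ → ℕ) (n : ℕ) :
    sig p j hj (∑ v ∈ range n, (c v : S p) * rho p ^ v) = ∑ v ∈ range n, (c v : S p) * (rho p ^ j) ^ v := by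
  rw [map_sum]
  exact Finset.sum_congr rfl fun v _ => by rw [map_mul, map_natCast, map_pow, sig_rho]

/-- A list sums to the sum of its entries over positions. [folklore] -/
theorem sum_eq_sum_getD : ∀ M : List ℕ, M.sum = ∑ i ∈ range M.length, M.getD i 0
  | [] => by simp
  | m :: M => by
    rw [List.sum_cons, List.length_cons, Finset.sum_range_succ', List.getD_cons_zero, sum_eq_sum_getD M, add_comm]
    simp only [List.getD_cons_succ]

/-- Re-indexing a sum over `range p` by multiplication with a unit mod `p`:
`Σ_u F((gi·u) mod p, u) = Σ_v F(v, (g·v) mod p)` when `g·gi ≡ 1`. [folklore] -/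
theorem sum_reindex_unit {β : Type*} [AddCommMonoid β] {g gi : ℕ} (hg : g * gi % p = 1) (F : ℕ → ℕ → β) :
    ∑ u ∈ range p, F (gi * u % p) u = ∑ v ∈ range p, F v (g * v % p) := by
  have hunit : ((gi : ℕ) : ZMod p) * ((g : ℕ) : ZMod p) = 1 := by
    have e : (((g * gi) % p : ℕ) : ZMod p) = 1 := by rw [hg, Nat.cast_one]
    rw [ZMod.natCast_mod, Nat.cast_mul] at e
    rw [mul_comm]; exact e
  have hU : IsUnit ((gi : ℕ) : ZMod p) := isUnit_iff_exists_inv.2 ⟨_, hunit⟩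
  have e1 : ∑ u ∈ range p, F (gi * u % p) u = ∑ u : ZMod p, F (((gi : ℕ) : ZMod p) * u).val u.val := by
    rw [← sum_val_eq_sum_range (fun u => F (gi * u % p) u)]
    refine Finset.sum_congr rfl fun u _ => ?_
    rw [ZMod.val_mul, ZMod.val_natCast, Nat.mod_mul_mod]
  have e2 : ∑ v ∈ range p, F v (g * v % p) = ∑ v : ZMod p, F v.val (((g : ℕ) : ZMod p) * v).val := by
    rw [← sum_val_eq_sum_range (fun v => F v (g * v % p))]
    refine Finset.sum_congr rfl fun v _ => ?_
    rw [ZMod.val_mul, ZMod.val_natCast, Nat.mod_mul_mod]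
  rw [e1, e2]
  refine Fintype.sum_equiv (hU.unit.mulLeft) _ _ fun u => ?_
  rw [Units.mulLeft_apply, IsUnit.unit_spec, ← mul_assoc, mul_comm ((g : ℕ) : ZMod p), hunit, one_mul]

omit hp in
/-- `g·gi ≡ 1 (mod p)` makes `p ∤ g`. [folklore] -/
theorem not_dvd_of_mul_mod_eq_one {g gi : ℕ} (hg : g * gi % p = 1) : ¬ p ∣ g := fun h => by
  have := Nat.dvd_trans h (Nat.dvd_mul_right g gi)
  rw [Nat.dvd_iff_mod_eq_zero] at this
  omega

/-- **`perm`**: the digit permutation realises `σ_g` (`g·gi ≡ 1 (mod p)`), keeps `mass`, stays below `X^p`. [folklore] -/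
theorem Phi_perm (hX : 0 < X) {g gi : ℕ} (hg : g * gi % p = 1) (a : ℕ) :
    Phi p X (perm p X gi a) = sig p g (not_dvd_of_mul_mod_eq_one hg) (Phi p X a) ∧
    mass p X (perm p X gi a) = mass p X a ∧ perm p X gi a < X ^ p := by
  set L := (List.range p).map fun u => a / X ^ (gi * u % p) % X with hL
  have hlt : ∀ x ∈ L, x < X := fun x hx => by
    rw [hL, List.mem_map] at hx
    obtain ⟨u, _, rfl⟩ := hx
    exact Nat.mod_lt _ hX
  have hlen : L.length = p := by rw [hL]; simp
  have hLget : ∀ u, u ∈ range p → L.getD u 0 = a / X ^ (gi * u % p) % X := fun u hu => by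
    rw [hL, getD_range_map _ (mem_range.1 hu)]
  refine ⟨?_, ?_, ?_⟩
  · rw [perm, ← hL, Phi_enc hX L hlt hlen.le, encR_eq_sum, hlen, Phi, sig_sum_pow]
    rw [Finset.sum_congr rfl fun u hu => by rw [hLget u hu]]
    rw [sum_reindex_unit hg (fun i u => ((a / X ^ i % X : ℕ) : S p) * rho p ^ u)]
    refine Finset.sum_congr rfl fun v _ => ?_
    rw [← pow_mul, pow_mod_eq_pow (root_pow_p p)]
  · rw [perm, ← hL, mass_enc hX L hlt hlen.le, mass, sum_eq_sum_getD, sum_eq_sum_getD, hlen, length_dl]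
    rw [Finset.sum_congr rfl fun u hu => by rw [hLget u hu], sum_reindex_unit hg (fun i _ => a / X ^ i % X)]
    exact Finset.sum_congr rfl fun v hv => by rw [dl_getD (mem_range.1 hv)]
  · rw [perm, ← hL]
    exact lt_of_lt_of_le (enc_lt _ hlt) (le_of_eq (by rw [hlen]))

/-- **`readInt`**: if the digits `1 … p−1` agree, `Phi a` is the integer `a₀ − a₁`. [folklore] -/
theorem Phi_eq_readInt {a : ℕ} (hc : isConst p X a = true) : Phi p X a = (readInt X a : S p) := by
  have hp1 : 1 < p := hp.out.one_lt
  obtain ⟨q, hq⟩ : ∃ q, p = q + 1 := ⟨p - 1, by omega⟩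
  subst hq
  unfold isConst at hc
  rw [List.all_eq_true] at hc
  have hdig : ∀ v, v < q → (((a / X ^ (v + 1) % X : ℕ) : S (q + 1)) = ((a / X % X : ℕ) : S (q + 1))) := by
    intro v hv
    have h := hc (v + 1) (List.mem_range.2 (by omega))
    rw [Bool.or_eq_true, decide_eq_true_eq, beq_iff_eq] at h
    rcases h with h | h
    · omega
    · rw [h]
  have hgeom : ∑ v ∈ range q, rho (q + 1) ^ (v + 1) = -1 := by
    have h := geom_sum_root (q + 1)
    rw [Finset.sum_range_succ', pow_zero] at h
    linear_combination h
  have e : ∑ v ∈ range (q + 1), ((a / X ^ v % X : ℕ) : S (q + 1)) * rho (q + 1) ^ v =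
      (∑ v ∈ range q, ((a / X % X : ℕ) : S (q + 1)) * rho (q + 1) ^ (v + 1)) + ((a % X : ℕ) : S (q + 1)) := by
    rw [Finset.sum_range_succ', pow_zero, Nat.div_one, pow_zero, mul_one]
    congr 1
    refine Finset.sum_congr rfl fun v hv => ?_
    rw [hdig v (mem_range.1 hv)]
  unfold Phi readInt
  rw [e, ← Finset.mul_sum, hgeom, Int.cast_sub, Int.cast_natCast, Int.cast_natCast]
  ring

end Sem

end LineNorm

end Summit.MatrixMultiplication.OmegaCensus
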